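import Summits.HodgeConjecture.HodgeConjecture.Theorems.MarkmanPartnerTransportPartnerTransport
import Summits.HodgeConjecture.HodgeConjecture.Theorems.MarkmanPartnerTransportPicardThreeK3SquaresHighPicard

/-!
# Route MarkmanPartnerTransport · HILBERT-SQUARE SECTORS of the target: the Hodge conjecture for `S^{[2]}`
# from the known K3-square sectors, modulo the Beauville/Fogarty double cover alone (+ Buskin/markings for CM)

`hodgeConjectureFor_hilbertSquare_of_square` (gen 6: `HC⁴(S × S) ⇒ HC⁴(S^{[2]})` for every smooth projective
surface, modulo the single named fact `HilbertScheme.Beauville1983_hilbertSquare_blowupDiagonal_surjection`)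
applied to the K3-square sectors that are THEOREMS of the tree — no partner, no Markman lift, no period
surjectivity needed:

* `hodgeConjectureFor_hilbertSquare_of_hodgeEndomorphisms_scalar` — **for every smooth projective surface
  `S` whose rational Hodge endomorphisms of `H²(S)` killing `N¹(S)` with transcendental image are rational
  scalars on `T(S)` (e.g. every K3 surface «general in its Picard rank», `End_Hdg T(S) = ℚ`), `HC⁴(S^{[2]})`**
  — modulo the double-cover fact ONLY (the `E = ℚ` kernel theorem for `S × S` is fact-free in the tree).
  Nearest print: Novario 2025 (Kyoto J. Math. 66) computes `H^{2,2}(S^{[2]}, ℤ)` for `S` general and finds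
  it spanned by `bᵢbⱼ, bᵢδ, δ², c₂` — algebraic classes; the rational statement here is thus PRINT-KNOWN for K3,
  stated for all surfaces with `E = ℚ`.
* `hodgeConjectureFor_hilbertSquare_of_CM` — `HC⁴(S^{[2]})` for every projective K3 surface with complex
  multiplication, modulo {double cover, `Buskin2019_hodgeIsometry_algebraic`, `Huybrechts_K3_marking_exists`}.
* `hodgeConjectureFor_hilbertSquare_of_seventeen_le` — `HC⁴(S^{[2]})` for every projective K3 surface with
  `ρ(S) ≥ 17`, same three facts.

CONDITIONAL (credit nothing). No definition, no sorry. Prover seat hodge-nonav-19652-p1 (gen 6),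
`--supports stmt-HodgeConjecture-19649`.

References: S. Novario, Kyoto J. Math. 66 (2026) 187–221 (arXiv:2112.11306), Thm. 6.2/8.3; A. Beauville,
J. Differential Geom. 18 (1983) §6; N. Buskin, J. reine angew. Math. 755 (2019) Thm. 1.1 and Corollary;
M. A. de Cataldo, L. Migliorini, J. Algebra 251 (2002) Thm. 6.2.1.
-/

noncomputable section

set_option linter.dupNamespace false

open Module CategoryTheory MonoidalCategory
open Literature.AlgebraicTopology.SingularHomology
open Literature.AlgebraicGeometry Literature.AlgebraicGeometry.Motives Literature.AlgebraicGeometry.HodgeTheory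
open Literature.AlgebraicGeometry.Hyperkaehler Literature.AlgebraicGeometry.Surfaces
open Literature.AlgebraicGeometry.HilbertScheme
open Summit.HodgeConjecture.HodgeConjecture.Theorems.NikulinTwinTransport
open Summit.HodgeConjecture.HodgeConjecture.Theorems.MarkmanPartnerTransport

namespace Summit.HodgeConjecture.HodgeConjecture.Theorems.MarkmanPartnerTransport.PartnerLattice

variable {S H : SchemeOver ℂ} {Ξ : (S ⊗ H).left.IdealSheafData}

/-- **HC⁴ for the Hilbert square of a smooth projective surface with `End_Hdg T(S) = ℚ`** (every rational
Hodge endomorphism of `H²(S)` killing `N¹(S)` with transcendental image is a rational scalar on `T(S)`), modulo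
the double-cover fact only: the tree's fact-free kernel theorem for `S × S` plus
`hodgeConjectureFor_hilbertSquare_of_square`. [cite: Novario2026HodgeClassesHilbertSquares, Thm. 6.2 and Thm. 8.3]
[cite: Beauville1983, §6 (e)–(f), p. 766] -/
theorem hodgeConjectureFor_hilbertSquare_of_hodgeEndomorphisms_scalar
    (hρ : Beauville1983_hilbertSquare_blowupDiagonal_surjection) (hS : IsSmoothProjective 2 S)
    (hHilb : IsHilbertSchemeOfPoints 2 S H Ξ) (hH : IsSmoothProjective 4 H)
    (hU₀ : ∀ (f : complexBetti S (2 * 1) →ₗ[ℂ] complexBetti S (2 * 1)),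
      (∀ y, IsRationalClass y → IsRationalClass (f y)) →
      (∀ (i j : ℕ) y, IsOfHodgeType 2 S (2 * 1) i j y → IsOfHodgeType 2 S (2 * 1) i j (f y)) →
      (∀ d ∈ algebraicClasses S 1, f d = 0) →
      (∀ y : complexBetti S (2 * 1), ∀ d ∈ algebraicClasses S 1,
        cupProduct (rfl : 2 * 1 + 2 * 1 = 2 * 2) (f y) d = 0) →
      ∃ a : ℚ, ∀ y : complexBetti S (2 * 1),
        (∀ d ∈ algebraicClasses S 1, cupProduct (rfl : 2 * 1 + 2 * 1 = 2 * 2) y d = 0) →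
        f y = (a : ℂ) • y) :
    HodgeConjectureFor 4 H :=
  hodgeConjectureFor_hilbertSquare_of_square hρ hS hHilb hH
    (SquareGlueFree.hodgeConjectureFor_square_of_hodgeEndomorphisms_scalar hS hU₀)

/-- **HC⁴ for the Hilbert square of a projective K3 surface with complex multiplication**, modulo the
double-cover fact, Buskin's Thm. 1.1 and K3 markings (Buskin's CM corollary for `S × S` is derived in the
tree, `CMThird.hodgeConjectureFor_square_of_CM_of_buskin`). [cite: Buskin2019, Corollary (after Thm. 1.1)]
[cite: Beauville1983, §6 (e)–(f), p. 766] -/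
theorem hodgeConjectureFor_hilbertSquare_of_CM (hρ : Beauville1983_hilbertSquare_blowupDiagonal_surjection)
    (hBu : Buskin2019_hodgeIsometry_algebraic) (hmark : Huybrechts_K3_marking_exists) (hS : IsK3Surface S)
    (hCM : HasComplexMultiplication S) (hHilb : IsHilbertSchemeOfPoints 2 S H Ξ) (hH : IsSmoothProjective 4 H) :
    HodgeConjectureFor 4 H :=
  hodgeConjectureFor_hilbertSquare_of_square hρ hS.isSmoothProjective hHilb hH
    (CMThird.hodgeConjectureFor_square_of_CM_of_buskin hBu hmark S hS hCM)

/-- **HC⁴ for the Hilbert square of a projective K3 surface with `ρ(S) ≥ 17`** (there `End_Hdg T(S)` is `ℚ`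
or CM), modulo the double-cover fact, Buskin's Thm. 1.1 and K3 markings. [cite: Vangeemen2008, Lemma 3.2]
[cite: Buskin2019, Thm. 1.1] [cite: Beauville1983, §6 (e)–(f), p. 766] -/
theorem hodgeConjectureFor_hilbertSquare_of_seventeen_le
    (hρ : Beauville1983_hilbertSquare_blowupDiagonal_surjection) (hBu : Buskin2019_hodgeIsometry_algebraic)
    (hmark : Huybrechts_K3_marking_exists) (hS : IsK3Surface S)
    (h17 : 17 ≤ Module.finrank ℂ (algebraicClasses S 1)) (hHilb : IsHilbertSchemeOfPoints 2 S H Ξ)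
    (hH : IsSmoothProjective 4 H) : HodgeConjectureFor 4 H :=
  hodgeConjectureFor_hilbertSquare_of_square hρ hS.isSmoothProjective hHilb hH
    (HighPicard.hodgeConjectureFor_square_of_seventeen_le hBu hmark hS h17)

end Summit.HodgeConjecture.HodgeConjecture.Theorems.MarkmanPartnerTransport.PartnerLattice

end
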